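import Literature.Probability.RandomPlanarGeometry.SAWCountMonotoneEscapeSpare
import Literature.MathematicalPhysics.QuantumLattice.WilsonLoops
import HarnessLib

/-!
# Monotonicity `cₙ ≤ cₙ₊₁` (O'Brien 1990): coordinate-ray escapes, the «prefer `+eₐ`» selector, and the
# ROTATION of a near-polygon — the pieces of a third rule acting on the residual

Sequel of `SAWCountMonotoneEscapeSpare.lean` (the spare-walk socket `cₙ ≤ cₙ₊₁ + #(R \ S)`: any injection of
`S` into free-ended `(n+1)`-step walks whose last step is not the selector's).  By
`SAWCountMonotoneEscapeOdd.lean` the residual `R(d, n)` is empty exactly for `n ≤ 6d - 3` odd / `8d - 6` even,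
and at the first failing odd length `n = 6d - 1` it consists of walks trapped at both ends; exhaustive
enumeration (lane «pcv-sawmu» a-p4 g27, kit j312058 / j312060; not used in proofs) shows that for
`d = 2, 3` EVERY walk of `R(d, 6d - 1)` is a **near-polygon** — its end is a neighbour of the origin, so
that the sites of the walk carry a lattice cycle of length `n + 1` — whose cycle has exactly one
«doubly-caged» edge.  A near-polygon can be ROTATED: cut the cycle at any vertex `u` and read it as an
`n`-step walk ending at `u` (`cycRot`); if `u` maximises a coordinate `a`, the rotated walk prolonged by a
free step `u + e_b`, `b ≠ a`, is a free-ended `(n+1)`-step walk (escape along the `a`-ray) whose last step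
is NOT the one chosen by the selector «prefer `+eₐ`» (`prefSel`) — i.e. a SPARE walk for the socket.  This
file provides these pieces; the injectivity bookkeeping of the resulting rule (which vertex, which
orientation) is left to the sequel.

* `isEscape_coordRay`, `endFree_of_coord_le` : if every site of the walk has `a`-coordinate `≤ M` and `y`
  is a free neighbour of the end with `yₐ ≥ M`, the ray `y, y + eₐ, y + 2eₐ, …` escapes;
* `prefSel`, `prefSel_isEscapeSelector`, `prefSel_eq_add_single` : the selector preferring the step
  `+eₐ`, and its value at a walk whose end maximises the `a`-coordinate;
* `spareExtension_mem_saws`, `endFree_spareExtension`, `spareExtension_ne_prefSel` : prolonging such a walk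
  by `+e_b`, `b ≠ a`, gives a spare free-ended walk;
* `cycIdx`, `cycRot`, `cycRot_mem_saws`, `cycRot_apply_last`, `exists_cycRot_eq` : the rotation of a
  near-polygon (an `n`-step self-avoiding walk whose end is adjacent to its start) at a cut index `j`.

[cite: MadrasSlade1993, §1.1; §7.1 p. 231 (`c_{N+1} ≥ c_N`, O'Brien)] [cite: BDGS2012, §1.3 (`cₙ ≤ cₙ₊₁`, O'Brien 1990)]
-/

noncomputable section

open Literature.Probability.LatticeModels Literature.Probability.Percolation SimpleGraph
open Literature.MathematicalPhysics.QuantumLattice (zdGraph_adj_add_single)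

namespace Literature.Probability.RandomPlanarGeometry.SAW.Zd

variable {d : ℕ}

/-! ### Coordinate rays -/

/-- **Escape along a coordinate ray.**  If every site `ω i`, `i ≤ n`, has `a`-coordinate `≤ M`, and `y` is a
free neighbour of the end with `M ≤ yₐ`, then `k ↦ y + k eₐ` is an escape route. [cite: MadrasSlade1993, §1.1] -/
theorem isEscape_coordRay {ω : ℕ → Site d} {n : ℕ} {y : Site d} (a : Fin d) {M : ℤ}
    (hM : ∀ i ≤ n, ω i a ≤ M) (hy : y ∈ freeNbrs ω n) (hyM : M ≤ y a) :
    IsEscape ω n (fun k => y + (k : ℤ) • (Pi.single a 1 : Site d)) := by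
  obtain ⟨hadj, hfree⟩ := mem_freeNbrs.1 hy
  refine ⟨by simpa using hadj, fun k => ?_, fun k k' h => ?_, fun k j hj h => ?_⟩
  · have := zdGraph_adj_add_single (y + (k : ℤ) • (Pi.single a 1 : Site d)) a
    convert this using 1
    push_cast; module
  · have h1 := congrFun h a
    simp only [Pi.add_apply, Pi.smul_apply, Pi.single_eq_same, smul_eq_mul, mul_one] at h1
    exact_mod_cast (add_left_cancel h1)
  · have h1 := congrFun h a
    simp only [Pi.add_apply, Pi.smul_apply, Pi.single_eq_same, smul_eq_mul, mul_one] at h1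
    have hle := hM j hj
    have hk : k = 0 := by
      have : (k : ℤ) ≤ 0 := by linarith
      omega
    subst hk
    exact hfree j hj (by rw [← h]; simp)

/-- The end is free as soon as a free neighbour of it is at least as far out in some coordinate as every
site of the walk. [cite: MadrasSlade1993, §1.1] -/
theorem endFree_of_coord_le {ω : ℕ → Site d} {n : ℕ} {y : Site d} (a : Fin d) {M : ℤ}
    (hM : ∀ i ≤ n, ω i a ≤ M) (hy : y ∈ freeNbrs ω n) (hyM : M ≤ y a) : EndFree ω n :=
  ⟨_, isEscape_coordRay a hM hy hyM⟩

/-- If the end maximises the `a`-coordinate, then `end + eₐ` is a free neighbour. [cite: MadrasSlade1993, §1.1] -/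
theorem add_single_mem_freeNbrs_of_coord_le {ω : ℕ → Site d} {n : ℕ} (a : Fin d)
    (hmax : ∀ i ≤ n, ω i a ≤ ω n a) : ω n + Pi.single a 1 ∈ freeNbrs ω n := by
  refine mem_freeNbrs.2 ⟨zdGraph_adj_add_single _ a, fun i hi h => ?_⟩
  have := congrFun h a
  simp only [Pi.add_apply, Pi.single_eq_same] at this
  have := hmax i hi
  omega

/-- If the end maximises the `a`-coordinate, then `end + eₐ` starts an escape route (the `a`-ray).
[cite: MadrasSlade1993, §1.1] -/
theorem isEscape_coordRay_end {ω : ℕ → Site d} {n : ℕ} (a : Fin d) (hmax : ∀ i ≤ n, ω i a ≤ ω n a) :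
    IsEscape ω n (fun k => ω n + Pi.single a 1 + (k : ℤ) • (Pi.single a 1 : Site d)) :=
  isEscape_coordRay a hmax (add_single_mem_freeNbrs_of_coord_le a hmax) (by simp)

/-! ### The selector preferring `+eₐ` -/

open Classical in
/-- **The escape-step selector preferring `+eₐ`**: take the step `+eₐ` from the end if it starts an escape
route, else any escape step (of the walk frozen at time `n`), else `0`. [cite: MadrasSlade1993, §1.1] -/
def prefSel (n : ℕ) (a : Fin d) (ω : ℕ → Site d) : Site d :=
  if ∃ P, IsEscape ω n P ∧ P 0 = ω n + Pi.single a 1 then ω n + Pi.single a 1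
  else if h : EndFree (restrictTo ω n) n then Classical.choose h 0 else 0

open Classical in
/-- `prefSel n a` is an escape-step selector. [cite: MadrasSlade1993, §1.1] -/
theorem prefSel_isEscapeSelector (n : ℕ) (a : Fin d) : IsEscapeSelector (d := d) n (prefSel n a) := by
  have hres : ∀ ω : ℕ → Site d, ∀ i ≤ n, restrictTo ω n i = ω i := fun ω i hi => by
    rw [restrictTo_apply, min_eq_left hi]
  refine ⟨fun ω hω => ?_, fun ω₁ ω₂ h => ?_⟩
  · unfold prefSel
    split_ifs with h1 h2
    · obtain ⟨P, hP, hP0⟩ := h1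
      exact ⟨P, hP, hP0⟩
    · exact ⟨Classical.choose h2, (isEscape_congr (hres ω) _).1 (Classical.choose_spec h2), rfl⟩
    · exact absurd ((endFree_congr (hres ω)).2 hω) h2
  · have hr : restrictTo ω₁ n = restrictTo ω₂ n := funext fun i => by
      rw [restrictTo_apply, restrictTo_apply]; exact h (min i n) (min_le_right _ _)
    have hex : (∃ P, IsEscape ω₁ n P ∧ P 0 = ω₁ n + Pi.single a 1) ↔
        (∃ P, IsEscape ω₂ n P ∧ P 0 = ω₂ n + Pi.single a 1) := by
      refine exists_congr fun P => ?_
      rw [isEscape_congr h P, h n le_rfl]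
    unfold prefSel
    by_cases h1 : ∃ P, IsEscape ω₁ n P ∧ P 0 = ω₁ n + Pi.single a 1
    · rw [if_pos h1, if_pos (hex.1 h1), h n le_rfl]
    · rw [if_neg h1, if_neg (fun h2 => h1 (hex.2 h2)), hr]

open Classical in
/-- **At a walk whose end maximises the `a`-coordinate the selector takes `+eₐ`.** [cite: MadrasSlade1993, §1.1] -/
theorem prefSel_eq_add_single {ω : ℕ → Site d} {n : ℕ} (a : Fin d) (hmax : ∀ i ≤ n, ω i a ≤ ω n a) :
    prefSel n a ω = ω n + Pi.single a 1 := by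
  unfold prefSel
  rw [if_pos ⟨_, isEscape_coordRay_end a hmax, by simp⟩]

/-! ### The spare extension `+e_b` of a walk whose end maximises the `a`-coordinate -/

/-- The `+e_b` neighbour of the end, as the site to append. [cite: MadrasSlade1993, §1.1] -/
def spareExtension (n : ℕ) (b : Fin d) (ω : ℕ → Site d) : ℕ → Site d :=
  extendTo ω n (ω n + Pi.single b 1)

/-- The spare extension is an `(n+1)`-step self-avoiding walk when `end + e_b` is unvisited.
[cite: MadrasSlade1993, §1.1] -/
theorem spareExtension_mem_saws {ω : ℕ → Site d} {n : ℕ} (hω : ω ∈ saws d n) (b : Fin d)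
    (hfree : ∀ i ≤ n, ω i ≠ ω n + Pi.single b 1) : spareExtension n b ω ∈ saws d (n + 1) :=
  extendTo_mem_saws hω (mem_freeNbrs.2 ⟨zdGraph_adj_add_single _ b, hfree⟩)

/-- Its last site. [cite: MadrasSlade1993, §1.1] -/
theorem spareExtension_apply_succ (n : ℕ) (b : Fin d) (ω : ℕ → Site d) :
    spareExtension n b ω (n + 1) = ω n + Pi.single b 1 :=
  extendTo_of_lt (Nat.lt_succ_self n)

/-- It agrees with `ω` up to time `n`. [cite: MadrasSlade1993, §1.1] -/
theorem spareExtension_apply_of_le {n i : ℕ} (b : Fin d) (ω : ℕ → Site d) (hi : i ≤ n) :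
    spareExtension n b ω i = ω i :=
  extendTo_of_le hi

/-- **The spare extension has a free end** when the old end maximises the `a`-coordinate and `b ≠ a`:
the `a`-ray from `end + e_b + e_a` escapes. [cite: MadrasSlade1993, §1.1] -/
theorem endFree_spareExtension {ω : ℕ → Site d} {n : ℕ} {a b : Fin d} (hab : a ≠ b)
    (hmax : ∀ i ≤ n, ω i a ≤ ω n a) : EndFree (spareExtension n b ω) (n + 1) := by
  set η := spareExtension n b ω with hη
  have hηn : η (n + 1) = ω n + Pi.single b 1 := spareExtension_apply_succ n b ω
  have hcoord : ∀ i ≤ n + 1, η i a ≤ ω n a := by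
    intro i hi
    rcases Nat.lt_or_ge i (n + 1) with h | h
    · rw [hη, spareExtension_apply_of_le b ω (Nat.lt_succ_iff.1 h)]; exact hmax i (by omega)
    · have : i = n + 1 := by omega
      rw [this, hηn, Pi.add_apply, Pi.single_eq_of_ne hab, add_zero]
  refine endFree_of_coord_le a hcoord (y := η (n + 1) + Pi.single a 1) ?_ ?_
  · refine mem_freeNbrs.2 ⟨zdGraph_adj_add_single _ a, fun i hi h => ?_⟩
    have h1 := congrFun h a
    rw [Pi.add_apply, Pi.single_eq_same] at h1
    have := hcoord i hi
    have h2 : η (n + 1) a = ω n a := by rw [hηn, Pi.add_apply, Pi.single_eq_of_ne hab, add_zero]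
    omega
  · rw [Pi.add_apply, Pi.single_eq_same, hηn, Pi.add_apply, Pi.single_eq_of_ne hab]; omega

/-- **The spare extension is spare for the selector preferring `+eₐ`**: its last site `end + e_b` is not
`prefSel n a` of it (which is `end + eₐ`). [cite: MadrasSlade1993, §1.1] -/
theorem spareExtension_ne_prefSel {ω : ℕ → Site d} {n : ℕ} {a b : Fin d} (hab : a ≠ b)
    (hmax : ∀ i ≤ n, ω i a ≤ ω n a) :
    spareExtension n b ω (n + 1) ≠ prefSel n a (spareExtension n b ω) := by
  have hmax' : ∀ i ≤ n, spareExtension n b ω i a ≤ spareExtension n b ω n a := by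
    intro i hi
    rw [spareExtension_apply_of_le b ω hi, spareExtension_apply_of_le b ω le_rfl]; exact hmax i hi
  rw [prefSel_eq_add_single a hmax', spareExtension_apply_succ, spareExtension_apply_of_le b ω le_rfl]
  intro h
  have := congrFun h a
  rw [Pi.add_apply, Pi.add_apply, Pi.single_eq_of_ne hab, Pi.single_eq_same] at this
  omega

/-- Summary in the format of the socket `count_le_count_succ_add_card_sdiff_of_spare` (selector
`prefSel n a`): the spare extension of an `n`-step self-avoiding walk whose end maximises the
`a`-coordinate and has `end + e_b` unvisited (`b ≠ a`) is an `(n+1)`-step self-avoiding walk with a free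
end and a non-selected last step. [cite: BDGS2012, §1.3] -/
theorem spareExtension_spare {ω : ℕ → Site d} {n : ℕ} (hω : ω ∈ saws d n) {a b : Fin d} (hab : a ≠ b)
    (hmax : ∀ i ≤ n, ω i a ≤ ω n a) (hfree : ∀ i ≤ n, ω i ≠ ω n + Pi.single b 1) :
    spareExtension n b ω ∈ saws d (n + 1) ∧ EndFree (spareExtension n b ω) (n + 1) ∧
      spareExtension n b ω (n + 1) ≠ prefSel n a (spareExtension n b ω) :=
  ⟨spareExtension_mem_saws hω b hfree, endFree_spareExtension hab hmax, spareExtension_ne_prefSel hab hmax⟩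

/-! ### Rotating a near-polygon -/

/-- The rotated time: `cycIdx n j t = (j + 1 + t) mod (n + 1)` for `t ≤ n`, written without `%`.
[cite: MadrasSlade1993, §1.1] -/
def cycIdx (n j t : ℕ) : ℕ := if j + 1 + t ≤ n then j + 1 + t else j + t - n

/-- `cycIdx n j t ≤ n` for `j, t ≤ n`. [cite: MadrasSlade1993, §1.1] -/
theorem cycIdx_le {n j t : ℕ} (hj : j ≤ n) (ht : t ≤ n) : cycIdx n j t ≤ n := by
  unfold cycIdx; split_ifs <;> omega

/-- `cycIdx n j n = j`. [cite: MadrasSlade1993, §1.1] -/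
theorem cycIdx_last (n j : ℕ) : cycIdx n j n = j := by
  unfold cycIdx; split_ifs <;> omega

/-- `cycIdx n j` is injective on `[0, n]`. [cite: MadrasSlade1993, §1.1] -/
theorem cycIdx_inj {n j t t' : ℕ} (ht : t ≤ n) (ht' : t' ≤ n)
    (h : cycIdx n j t = cycIdx n j t') : t = t' := by
  unfold cycIdx at h; split_ifs at h <;> omega

/-- Every index `i ≤ n` is a rotated time. [cite: MadrasSlade1993, §1.1] -/
theorem exists_cycIdx_eq {n j i : ℕ} (hj : j ≤ n) (hi : i ≤ n) : ∃ t ≤ n, cycIdx n j t = i := by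
  by_cases h : j + 1 ≤ i
  · exact ⟨i - (j + 1), by omega, by unfold cycIdx; rw [if_pos (by omega)]; omega⟩
  · exact ⟨i + n - j, by omega, by unfold cycIdx; rw [if_neg (by omega)]; omega⟩

/-- The successor of a rotated time: one step along the cycle (`n ↦ 0` across the closing edge).
[cite: MadrasSlade1993, §1.1] -/
theorem cycIdx_succ {n j t : ℕ} (hj : j ≤ n) (ht : t < n) :
    (cycIdx n j t < n ∧ cycIdx n j (t + 1) = cycIdx n j t + 1) ∨
      (cycIdx n j t = n ∧ cycIdx n j (t + 1) = 0) := by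
  unfold cycIdx; split_ifs <;> omega

/-- **The rotation of a near-polygon at the cut index `j`**: read the cycle `ω 0, …, ω n, ω 0` starting just
after `ω j`, translated to start at the origin; it ends at (the translate of) `ω j`.
[cite: MadrasSlade1993, §1.1] -/
def cycRot (n : ℕ) (ω : ℕ → Site d) (j : ℕ) : ℕ → Site d :=
  fun t => ω (cycIdx n j (min t n)) - ω (cycIdx n j 0)

/-- **The rotation is an `n`-step self-avoiding walk** when `ω` is one whose end is adjacent to its start.
[cite: MadrasSlade1993, §1.1] -/
theorem cycRot_mem_saws {ω : ℕ → Site d} {n : ℕ} (hω : ω ∈ saws d n)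
    (hclose : (zdGraph d).Adj (ω n) (ω 0)) {j : ℕ} (hj : j ≤ n) : cycRot n ω j ∈ saws d n := by
  obtain ⟨h0, -, hadj, hinj⟩ := mem_saws.1 hω
  have hinj' : ∀ i ≤ n, ∀ i' ≤ n, ω i = ω i' → i = i' := fun i hi i' hi' h =>
    hinj (show i ∈ {i | i ≤ n} from hi) (show i' ∈ {i | i ≤ n} from hi') h
  refine mem_saws.2 ⟨by simp [cycRot], fun t ht => by simp [cycRot, min_eq_right ht], fun t ht => ?_,
    fun t ht t' ht' h => ?_⟩
  · simp only [cycRot, min_eq_left ht.le, min_eq_left (Nat.succ_le_of_lt ht)]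
    refine (zdGraph_adj_sub_right _ _ _).2 ?_
    rcases cycIdx_succ hj ht with ⟨hlt, hs⟩ | ⟨heq, hs⟩
    · rw [hs]; exact hadj _ hlt
    · rw [hs, heq]; exact hclose
  · simp only [Set.mem_setOf_eq] at ht ht'
    simp only [cycRot, min_eq_left ht, min_eq_left ht', sub_left_inj] at h
    exact cycIdx_inj ht ht' (hinj' _ (cycIdx_le hj ht) _ (cycIdx_le hj ht') h)

/-- The rotated walk ends at the translate of the cut vertex `ω j`. [cite: MadrasSlade1993, §1.1] -/
theorem cycRot_apply_last (ω : ℕ → Site d) (n j : ℕ) :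
    cycRot n ω j n = ω j - ω (cycIdx n j 0) := by
  simp [cycRot, cycIdx_last n j]

/-- The sites of the rotated walk are the translates of the sites of `ω`. [cite: MadrasSlade1993, §1.1] -/
theorem exists_cycRot_eq {ω : ℕ → Site d} {n j i : ℕ} (hj : j ≤ n) (hi : i ≤ n) :
    ∃ t ≤ n, cycRot n ω j t = ω i - ω (cycIdx n j 0) := by
  obtain ⟨t, ht, hti⟩ := exists_cycIdx_eq hj hi
  exact ⟨t, ht, by simp [cycRot, min_eq_left ht, hti]⟩

/-- Conversely every site of the rotated walk is a translate of a site of `ω`. [cite: MadrasSlade1993, §1.1] -/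
theorem cycRot_apply_of_le {ω : ℕ → Site d} {n j t : ℕ} (ht : t ≤ n) :
    cycRot n ω j t = ω (cycIdx n j t) - ω (cycIdx n j 0) := by
  simp [cycRot, min_eq_left ht]

/-- Rotating at the last index does nothing (walks from the origin, frozen after time `n`).
[cite: MadrasSlade1993, §1.1] -/
theorem cycRot_last {ω : ℕ → Site d} {n : ℕ} (hω : ω ∈ saws d n) : cycRot n ω n = ω := by
  obtain ⟨h0, hend, -, -⟩ := mem_saws.1 hω
  funext t
  have h1 : ∀ s ≤ n, cycIdx n n s = s := fun s hs => by unfold cycIdx; split_ifs <;> omega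
  simp only [cycRot, h1 (min t n) (min_le_right _ _), h1 0 (Nat.zero_le _), h0, sub_zero]
  rcases le_total t n with h | h
  · rw [min_eq_left h]
  · rw [min_eq_right h, hend t h]

/-- **Rotating back**: the rotation at `j < n` followed by the rotation at `n - 1 - j` is the identity on
`n`-step self-avoiding walks — the left inverse needed for the injectivity of the near-polygon rule.
[cite: MadrasSlade1993, §1.1] -/
theorem cycRot_cycRot {ω : ℕ → Site d} {n j : ℕ} (hω : ω ∈ saws d n) (hj : j < n) :
    cycRot n (cycRot n ω j) (n - 1 - j) = ω := by
  obtain ⟨h0, hend, -, -⟩ := mem_saws.1 hω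
  have hcomp : ∀ s ≤ n, cycIdx n j (cycIdx n (n - 1 - j) s) = s := fun s hs => by
    unfold cycIdx; split_ifs <;> omega
  have hle : ∀ s ≤ n, cycIdx n (n - 1 - j) s ≤ n := fun s hs => by unfold cycIdx; split_ifs <;> omega
  funext t
  simp only [cycRot]
  rw [min_eq_left (hle _ (min_le_right t n)), min_eq_left (hle 0 (Nat.zero_le n)),
    hcomp _ (min_le_right t n), hcomp 0 (Nat.zero_le n), h0, zero_sub, sub_neg_eq_add, sub_add_cancel]
  rcases le_total t n with h | h
  · rw [min_eq_left h]
  · rw [min_eq_right h, hend t h]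

/-- **The near-polygon rule, one image.**  Let `ω` be an `n`-step self-avoiding walk whose end is adjacent
to its start (a near-polygon), `j ≤ n` a cut index such that `ω j` maximises the `a`-coordinate among the
sites of `ω`, and `b ≠ a` a direction with `ω j + e_b` unvisited.  Then the rotation at `j` prolonged by
`+e_b` is an `(n+1)`-step self-avoiding walk with a FREE end whose last step is not the one selected by
`prefSel n a` — a spare walk for `count_le_count_succ_add_card_sdiff_of_spare`. [cite: BDGS2012, §1.3] -/
theorem nearPolygon_spare {ω : ℕ → Site d} {n : ℕ} (hω : ω ∈ saws d n)
    (hclose : (zdGraph d).Adj (ω n) (ω 0)) {j : ℕ} (hj : j ≤ n) {a b : Fin d} (hab : a ≠ b)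
    (hmax : ∀ i ≤ n, ω i a ≤ ω j a) (hfree : ∀ i ≤ n, ω i ≠ ω j + Pi.single b 1) :
    spareExtension n b (cycRot n ω j) ∈ saws d (n + 1) ∧
      EndFree (spareExtension n b (cycRot n ω j)) (n + 1) ∧
      spareExtension n b (cycRot n ω j) (n + 1) ≠ prefSel n a (spareExtension n b (cycRot n ω j)) := by
  refine spareExtension_spare (cycRot_mem_saws hω hclose hj) hab (fun t ht => ?_) (fun t ht h => ?_)
  · rw [cycRot_apply_of_le ht, cycRot_apply_last ω n j, Pi.sub_apply, Pi.sub_apply]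
    have := hmax _ (cycIdx_le hj ht)
    omega
  · rw [cycRot_apply_of_le ht, cycRot_apply_last ω n j, sub_add_eq_add_sub, sub_left_inj] at h
    exact hfree _ (cycIdx_le hj ht) h

end Literature.Probability.RandomPlanarGeometry.SAW.Zd
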